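import Literature.Probability.LatticeModels.LocalParafermionicTemplate
import Literature.Probability.Percolation.FourArmGarbanOrthogonality
import Literature.Probability.Percolation.FKLoopNestingPercolationBridge
import Literature.Probability.Percolation.BlockConditioning
import HarnessLib

/-!
# Stub `stub_obsEqBlockAverage` of crux `DualCurrentTemplateR` (stmt-CriticalPhenomena-11201),
# line `birth`

The observable `T.obs D x i` of a local parafermionic template `T` in a discrete Dobrushin domain
`D` of `ℤ²`, at a deep base point `x` of type `i`, is the `P_{1/2}`-expectation of the integrand
`f ω = ∑_k g i k {e | edist (s(0,e_i)) e ≤ r ∧ x + e ∈ ω} · passageSum (γ_D(ω)) (s i k) (x + z i k)`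
(`LocalParafermionicTemplate.obs_eq`).  For every finite set of lattice edges `E` with
`E(Ω_δ) ⊆ E ⊆ E(ℤ²)` it equals the uniform average of `f` over the `2^|E|` sub-configurations
of `E`:

1. `f` reads `ω` only through `ω ∩ E`: the window pattern only tests translated window edges,
   which depth puts in `D.innerMedialVertices ⊆ E(Ω_δ) ⊆ E`, and the exploration path
   `fkInterface D ω = medialExploration D ω` only reads the completed configuration
   `D.bcBondConfig ω`, a function of `ω ∩ E(Ω_δ)` (`bcBondConfig_eq_of_inter_eq`); so
   `f ω = f (obs ω E)` with `obs ω E = ω ∩ E` (`coe_obs`).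
2. `E_p[h(obs E)] = ∑_{ξ ⊆ E} P_p(obs E = ξ) h ξ` (finite sum of indicators; complex-valued
   version of `integral_comp_obs_eq_sum`).
3. At `p = 1/2`, `{obs E = ξ}` is the cylinder event `cylinderEvent E ξ`, of probability
   `2^{-|E|}` (`bondPercolation_half_cylinderEvent`: each coordinate factor
   `½ δ_True + ½ δ_False` gives mass `½` to either prescribed value).

References: G. Grimmett, *Percolation* (1999), §1.3 (product measure); S. Smirnov (2001), §2 (the
exploration path reads the completed configuration only).
-/

noncomputable section

open MeasureTheory Literature.Probability Literature.Probability.LatticeModels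
open Literature.Probability.Percolation

namespace Summit.CriticalPhenomena.CardyFormulaZ2.Theorems

/-! ### The exploration path only reads the edges of the discrete domain -/

/-- Intersecting the configuration with a set containing `E(Ω_δ)` does not change the completed
configuration. [folklore] -/
private theorem bcBondConfig_inter_eq_of_subset (D : DiscreteDobrushin) {S : Set (Sym2 (Site 2))}
    (hS : (discreteDomainGraph D.Ω D.δ).edgeSet ⊆ S) (ω : BondConfig (Site 2)) :
    D.bcBondConfig (ω ∩ S) = D.bcBondConfig ω :=
  bcBondConfig_eq_of_inter_eq (by rw [Set.inter_assoc, Set.inter_eq_right.2 hS])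

/-- Exploration paths only depend on the completed configuration. [folklore] -/
private theorem isMedialExploration_congr' (D : DiscreteDobrushin) {ω ω' : BondConfig (Site 2)}
    (h : D.bcBondConfig ω = D.bcBondConfig ω') (γ : List MedialVertex) :
    IsMedialExploration D ω γ ↔ IsMedialExploration D ω' γ := by
  constructor
  · intro hγ
    exact { ne_nil := hγ.ne_nil, step := hγ.step, turn := h ▸ hγ.turn, nodup := hγ.nodup,
            head_mem := hγ.head_mem, getLast_mem := hγ.getLast_mem,
            head_ne_getLast := hγ.head_ne_getLast, start := hγ.start }
  · intro hγ
    exact { ne_nil := hγ.ne_nil, step := hγ.step, turn := h.symm ▸ hγ.turn, nodup := hγ.nodup,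
            head_mem := hγ.head_mem, getLast_mem := hγ.getLast_mem,
            head_ne_getLast := hγ.head_ne_getLast, start := hγ.start }

/-- Hence so does the chosen exploration path `medialExploration` (junk branch included).
[folklore] -/
private theorem medialExploration_congr' (D : DiscreteDobrushin) {ω ω' : BondConfig (Site 2)}
    (h : D.bcBondConfig ω = D.bcBondConfig ω') :
    medialExploration D ω = medialExploration D ω' := by
  classical
  have hP : IsMedialExploration D ω = IsMedialExploration D ω' :=
    funext fun γ => propext (isMedialExploration_congr' D h γ)
  unfold medialExploration
  exact congrArg (fun P : List MedialVertex → Prop =>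
    if hp : ∃! γ, P γ then hp.exists.choose else ([] : List MedialVertex)) hP

/-- The FK interface of `ω ∩ S` is that of `ω` whenever `E(Ω_δ) ⊆ S`. [folklore] -/
private theorem fkInterface_inter_eq (D : DiscreteDobrushin) {S : Set (Sym2 (Site 2))}
    (hS : (discreteDomainGraph D.Ω D.δ).edgeSet ⊆ S) (ω : BondConfig (Site 2)) :
    fkInterface D (ω ∩ S) = fkInterface D ω :=
  medialExploration_congr' D (bcBondConfig_inter_eq_of_subset D hS ω)

/-! ### Expectations of block functions -/

/-- **Expectation of a (complex-valued) function of the block**: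
`E_p[h(obs B)] = Σ_{ξ ⊆ B} P_p(obs B = ξ) h(ξ)`. [folklore] -/
private theorem integral_comp_obs_eq_sum_complex {V : Type*} (G : SimpleGraph V)
    (p : unitInterval) (B : Finset (Sym2 V)) (h : Finset (Sym2 V) → ℂ) :
    ∫ ω, h (obs ω B) ∂(bondPercolation G p) =
      ∑ ξ ∈ B.powerset, ((bondPercolation G p).real {ω | obs ω B = ξ} : ℂ) * h ξ := by
  have hpt : (fun ω : BondConfig V => h (obs ω B)) = fun ω =>
      ∑ ξ ∈ B.powerset, {ω : BondConfig V | obs ω B = ξ}.indicator (fun _ => h ξ) ω := by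
    funext ω
    rw [Finset.sum_eq_single_of_mem (obs ω B) (Finset.mem_powerset.2 (obs_subset ω B))
      fun ξ _ hne => ?_]
    · rw [Set.indicator_of_mem (show ω ∈ {ω' : BondConfig V | obs ω' B = obs ω B} from rfl)]
    · exact Set.indicator_of_notMem (show ω ∉ {ω' : BondConfig V | obs ω' B = ξ} from
        fun h' => hne h'.symm) _
  rw [hpt, integral_finsetSum _ fun ξ _ =>
    (integrable_const (h ξ)).indicator (measurableSet_setOf_obs B (· = ξ))]
  refine Finset.sum_congr rfl fun ξ _ => ?_
  rw [integral_indicator_const _ (measurableSet_setOf_obs B (· = ξ)), Complex.real_smul]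

/-- The block cylinder `{obs E = ξ}` (`ξ ⊆ E`) is the cylinder event `cylinderEvent E ξ`.
[folklore] -/
private theorem setOf_obs_eq_eq_cylinderEvent {E ξ : Finset (Sym2 (Site 2))} (hξ : ξ ⊆ E) :
    {ω : BondConfig (Site 2) | obs ω E = ξ} = cylinderEvent E ξ := by
  ext ω
  simp only [Set.mem_setOf_eq, mem_cylinderEvent_iff]
  constructor
  · intro h e he
    rw [← h, mem_obs_iff]
    exact ⟨fun hω => ⟨he, hω⟩, fun h' => h'.2⟩
  · intro h
    ext e
    rw [mem_obs_iff]
    constructor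
    · rintro ⟨he, hω⟩
      exact (h e he).1 hω
    · intro heξ
      exact ⟨hξ heξ, (h e (hξ heξ)).2 heξ⟩

/-- **Uniform `E`-marginal at `p = 1/2`**: for a finite set `E` of edges of `ℤ²` and `ξ ⊆ E`,
`P_{1/2}(obs E = ξ) = 2^{-|E|}`. [folklore] -/
private theorem measureReal_setOf_obs_eq_half {E ξ : Finset (Sym2 (Site 2))}
    (hE : (↑E : Set (Sym2 (Site 2))) ⊆ (zdGraph 2).edgeSet) (hξ : ξ ⊆ E) :
    (bondPercolation (zdGraph 2) half).real {ω | obs ω E = ξ} = (1 / 2) ^ E.card := by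
  rw [setOf_obs_eq_eq_cylinderEvent hξ, measureReal_def, bondPercolation_half_cylinderEvent]
  have hfac : ∀ e ∈ E,
      ((unitInterval.toNNReal half • Measure.dirac (e ∈ (zdGraph 2).edgeSet) +
        unitInterval.toNNReal (unitInterval.symm half) • Measure.dirac False : Measure Prop)
        {q | q ↔ e ∈ ξ}) = ENNReal.ofReal (1 / 2) := by
    intro e he
    have heT : (e ∈ (zdGraph 2).edgeSet) = True := propext ⟨fun _ => trivial, fun _ => hE he⟩
    have hsymm : unitInterval.symm half = half :=
      Subtype.ext (by rw [unitInterval.coe_symm_eq, coe_half]; norm_num)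
    have hnn : (unitInterval.toNNReal half : ENNReal) = ENNReal.ofReal (1 / 2) := by
      rw [← coe_half, ← unitInterval.coe_toNNReal, ENNReal.ofReal_coe_nnreal]
    by_cases hx : e ∈ ξ
    · have hset : {q : Prop | q ↔ e ∈ ξ} = {True} := by
        ext q; simp only [Set.mem_setOf_eq, Set.mem_singleton_iff, hx, iff_true, eq_iff_iff]
      rw [hset, heT, hsymm]
      simp [hnn]
    · have hset : {q : Prop | q ↔ e ∈ ξ} = {False} := by
        ext q; simp only [Set.mem_setOf_eq, Set.mem_singleton_iff, hx, iff_false, eq_iff_iff]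
      rw [hset, heT, hsymm]
      simp [hnn]
  rw [Finset.prod_congr rfl hfac, Finset.prod_const, ENNReal.toReal_pow,
    ENNReal.toReal_ofReal (by norm_num : (0 : ℝ) ≤ 1 / 2)]

/-! ### The stub -/

/-- Signature `Sig.stub_obsEqBlockAverage` of line `birth` of crux stmt-CriticalPhenomena-11201
(`CardyDualCurrent.DualCurrentTemplateR`), restated VERBATIM from the skeleton
`Cruxes/DualCurrentTemplateR/Lines/birth.lean` (which cannot be imported: it carries the open
stubs), so that this file's `stub_obsEqBlockAverage` closes the registered stub by name and
signature; the two `Sig` definitions unfold to the same term (asserted nowhere: it is only the type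
of `stub_obsEqBlockAverage`). In an admissible domain, at a deep base point, the template
observable is the uniform average of its integrand over the sub-configurations of any finite set
of lattice edges containing `E(Ω_δ)`. -/
def Sig.stub_obsEqBlockAverage : Prop :=
  ∀ (T : LocalParafermionicTemplate) (D : DiscreteDobrushin) (E : Finset MedialVertex),
    D.IsZdAdmissible → (discreteDomainGraph D.Ω D.δ).edgeSet ⊆ (↑E : Set MedialVertex) →
    (↑E : Set MedialVertex) ⊆ (zdGraph 2).edgeSet →
    ∀ (x : Site 2) (i : Fin 2), T.IsDeep D x i →
      T.obs D x i = ((2 : ℂ) ^ E.card)⁻¹ * ∑ η ∈ E.powerset,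
        ∑ k, T.g i k {e | medialGraph.edist s((0 : Site 2), Pi.single i 1) e ≤ (T.r : ℕ∞) ∧
            Sym2.map (· + x) e ∈ (↑η : Set MedialVertex)} *
          passageSum (fkInterface D (↑η : Set MedialVertex)) D.δ (T.s i k)
            (Sym2.map (· + x) (T.z i k))

/-- **The observable of an admissible domain at a deep point is a finite uniform average** (the
statement of `Sig.stub_obsEqBlockAverage`, unfolded; the admissibility hypothesis is not needed).
In a discrete Dobrushin domain `D`, for a finite set `E` of lattice edges with
`E(Ω_δ) ⊆ E ⊆ E(ℤ²)`, at a deep base point `x` of type `i` the template observable `T.obs D x i`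
is the uniform average over the `2^|E|` sub-configurations `η ⊆ E` of its integrand: the
integrand is a function of `ω ∩ E` (depth puts the translated window inside `E(Ω_δ) ⊆ E`, and
the exploration path reads only `D.bcBondConfig ω`, a function of `ω ∩ E(Ω_δ)`), and the
`E`-marginal of `P_{1/2}` is uniform. [folklore] -/
theorem obs_eq_uniform_blockAverage (T : LocalParafermionicTemplate) (D : DiscreteDobrushin)
    (E : Finset MedialVertex)
    (hEΩ : (discreteDomainGraph D.Ω D.δ).edgeSet ⊆ (↑E : Set MedialVertex))
    (hEzd : (↑E : Set MedialVertex) ⊆ (zdGraph 2).edgeSet) (x : Site 2) (i : Fin 2)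
    (hx : T.IsDeep D x i) :
    T.obs D x i = ((2 : ℂ) ^ E.card)⁻¹ * ∑ η ∈ E.powerset,
      ∑ k, T.g i k {e | medialGraph.edist s((0 : Site 2), Pi.single i 1) e ≤ (T.r : ℕ∞) ∧
          Sym2.map (· + x) e ∈ (↑η : Set MedialVertex)} *
        passageSum (fkInterface D (↑η : Set MedialVertex)) D.δ (T.s i k)
          (Sym2.map (· + x) (T.z i k)) := by
  -- the integrand, as a function of the configuration
  set f : BondConfig (Site 2) → ℂ := fun ω =>
    ∑ k, T.g i k {e | medialGraph.edist s((0 : Site 2), Pi.single i 1) e ≤ (T.r : ℕ∞) ∧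
        Sym2.map (· + x) e ∈ ω} *
      passageSum (fkInterface D ω) D.δ (T.s i k) (Sym2.map (· + x) (T.z i k)) with hf
  -- (1) the integrand reads `ω` only through `ω ∩ E`
  have hinter : ∀ ω : BondConfig (Site 2), f (ω ∩ ↑E) = f ω := by
    intro ω
    have hpat : {e | medialGraph.edist s((0 : Site 2), Pi.single i 1) e ≤ (T.r : ℕ∞) ∧
        Sym2.map (· + x) e ∈ ω ∩ (↑E : Set MedialVertex)} =
        {e | medialGraph.edist s((0 : Site 2), Pi.single i 1) e ≤ (T.r : ℕ∞) ∧
          Sym2.map (· + x) e ∈ ω} := by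
      ext e
      simp only [Set.mem_setOf_eq, Set.mem_inter_iff]
      exact ⟨fun h => ⟨h.1, h.2.1⟩, fun h =>
        ⟨h.1, h.2, hEΩ ((D.mem_innerMedialVertices_iff).1 (hx e h.1)).1⟩⟩
    simp only [hf, hpat, fkInterface_inter_eq D hEΩ ω]
  have hfac : ∀ ω : BondConfig (Site 2), f ω = f ↑(obs ω E) := fun ω => by
    rw [coe_obs, hinter]
  -- (2) finite Fubini over the block `E`
  have hobs : T.obs D x i = ∫ ω, f ω ∂(bondPercolation (zdGraph 2) half) := rfl
  rw [hobs, funext hfac,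
    integral_comp_obs_eq_sum_complex (zdGraph 2) half E (fun ξ => f ↑ξ), Finset.mul_sum]
  -- (3) the `E`-marginal of `P_{1/2}` is uniform
  refine Finset.sum_congr rfl fun η hη => ?_
  rw [measureReal_setOf_obs_eq_half hEzd (Finset.mem_powerset.1 hη)]
  push_cast
  rw [one_div, inv_pow]

/-- Registered stub `stub_obsEqBlockAverage` (signature `Sig.stub_obsEqBlockAverage`, unfolded
verbatim) of line `birth` of crux stmt-CriticalPhenomena-11201
(`CardyDualCurrent.DualCurrentTemplateR`). The observable of an admissible domain at a deep point
is the uniform average of its integrand over the sub-configurations of any finite edge set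
`E(Ω_δ) ⊆ E ⊆ E(ℤ²)` (`obs_eq_uniform_blockAverage`; the admissibility hypothesis is not even
needed). -/
theorem stub_obsEqBlockAverage : Sig.stub_obsEqBlockAverage :=
  fun T D E _ hEΩ hEzd x i hx => obs_eq_uniform_blockAverage T D E hEΩ hEzd x i hx

end Summit.CriticalPhenomena.CardyFormulaZ2.Theorems

end
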